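import Summits.QuantumFields.YangMills.Theorems.SmallFieldWideningLargeFieldMassRefinementTailProfileMono

/-!
# Route `SmallFieldWidening` — THE COMPOSITION READ PER BLOCK SIZE, and the admissible-block / floored closers
# (support file on the assembly axis; seat `ym-line-sfw-p1` gen 6, item of record `WideningOfTiltAndMass` stmt-QuantumFields-22885)

Route `route-QuantumFields-SmallFieldWidening` closes the rung-R3 leaf `T3YM3TorusStatement.YM3TorusSU2` (every odd block size
`L > 1`, ONE threshold `γ₁`) from r2 `AllHeightsSmallTilt` (stmt-QuantumFields-22883), r3 `LargeFieldMassRefinementTail` (22884) and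
the proved widening s9 (22885) by `Theses.SmallFieldWidening.closes`.  Both cruxes are `∀ L` statements and the composition never
mixes block sizes (r2 is applied to the refined families `F.refine n`, whose block size is `F.L` by `rfl`).  Bałaban's inputs are
printed at ONE fixed admissible block size — «L is an odd, positive integer > 11» ([Balaban1987RG1] §0 p. 251; the d = 3 stability
chain takes `L` small, [Balaban1985UV3] (1)–(3) p. 256) —, so the partner cruxes may well land block size by block size, or only
above a floor.  This file records in the kernel that the assembly survives that (the twin of `UnitScaleTiltAdmissibleBlocks`):

* §1 `yM3TorusSU2At_of_bodies` — for ONE block size `L₀`: the THRESHOLDED r2 body at `L₀` (profiles beyond `(b₁, p₁)`, route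
  `UnitScaleTilt`'s quantifier shape; the filed r2 is the case `b₁ = p₁ = 0`) and the r3 body at `L₀` give the fixed-block-size leaf
  `T3YM3TorusStatement.YM3TorusSU2At L₀` (`γ₁ = 1`; r3's existential profile pushed beyond the thresholds at `L₀` by
  `refinedMass_mono_profile`; then `closes` verbatim through the landed widening `smallFieldWidening_wideningOfTiltAndMass_proof`).
* §2 the FLOORED closers: r2 and r3 bodies for every (odd) block size `L ≥ L₁` give `YM3TorusSU2At L₀` for every `L₀ ≥ L₁`
  (`yM3TorusSU2At_of_bodies_from`, `…_from_odd`), and with `L₁ ≤ 12` the print-faithful admissible-block form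
  `T3YM3TorusStatement.YM3TorusSU2Adm` (odd `L₀ > 11`) (`yM3TorusSU2Adm_of_bodies_from`); r2 BY NAME + r3 floored
  (`yM3TorusSU2Adm_of_allHeightsSmallTilt_of_from`) and r3 BY NAME + r2 floored (`yM3TorusSU2Adm_of_from_of_largeFieldMassRefinementTail`).
* §3 sanity: the unfloored cruxes BY NAME give every `YM3TorusSU2At L₀` (`yM3TorusSU2At_of_cruxes`).

Pure bookkeeping over tree theorems; nothing of Bałaban's or King's is asserted, no crux is assumed outside the hypotheses, and NO
statement about which block sizes the cruxes hold for is made here.  No summit is proved (rung-R3 record readings only; the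
Yang–Mills mass gap is untouched).
-/

set_option autoImplicit false

noncomputable section

open MeasureTheory Filter Topology
open Literature.MathematicalPhysics.QuantumFieldTheory
open Literature.MathematicalPhysics.QuantumFieldTheory.Balaban1983to89
open Literature.MathematicalPhysics.QuantumFieldTheory.Balaban1983to89.Missing
open Literature.MathematicalPhysics.QuantumFieldTheory.Balaban1983to89.T3ContinuumYM3Torus
open Literature.MathematicalPhysics.QuantumFieldTheory.Balaban1983to89.T3YM3TorusStatement
open Literature.MathematicalPhysics.QuantumFieldTheory.Balaban1983to89.T3UnitScaleTilt
open Literature.MathematicalPhysics.QuantumFieldTheory.Balaban1983to89.T3UnitLawDensityEML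
open Summit.QuantumFields.YangMills.Theses.SmallFieldWidening
open Summit.QuantumFields.YangMills.Theorems.LargeFieldMassRefinementTailProfileMono (refinedMass_mono_profile)

namespace Summit.QuantumFields.YangMills.Theorems.SmallFieldWideningBlocks

/-! ## §1 The composition at one block size -/

/-- **r3's BODY AT ONE BLOCK SIZE, PUSHED BEYOND ARBITRARY THRESHOLDS** (`max`/`min` of the given witnesses, same `δ`;
`refinedMass_mono_profile`): the per-`L₀` form of `largeFieldMassRefinementTail_beyond`. [cite: Balaban1985UV3, (7) p.257] -/
theorem refinedMassBody_beyond (L₀ : ℕ) (b₁ p₁ : ℝ)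
    (hM : ∃ (b₀ p₀ γ₁ : ℝ), 0 < b₀ ∧ 2 < p₀ ∧ 0 < γ₁ ∧ ∀ (F : T3Family) (γ : ℝ), F.L = L₀ → 0 < γ →
      ∃ δ : ℕ → ℝ, Tendsto δ atTop (𝓝 0) ∧ ∀ n K : ℕ, γ * ((F.L : ℝ)⁻¹) ^ n ≤ γ₁ →
        (gibbsK (F.refine n) ℰp (γ * ((F.L : ℝ)⁻¹) ^ n) K).real
          (histGood (F.refine n) ℰp (θBal (F.refine n).L (γ * ((F.L : ℝ)⁻¹) ^ n) b₀ p₀) K 0)ᶜ ≤ δ n) :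
    ∃ b₀ p₀ γ₁ : ℝ, b₁ ≤ b₀ ∧ p₁ ≤ p₀ ∧ 0 < b₀ ∧ 2 < p₀ ∧ 0 < γ₁ ∧ γ₁ ≤ 1 ∧
      ∀ (F : T3Family) (γ : ℝ), F.L = L₀ → 0 < γ → ∃ δ : ℕ → ℝ, Tendsto δ atTop (𝓝 0) ∧
        ∀ n K : ℕ, γ * ((F.L : ℝ)⁻¹) ^ n ≤ γ₁ →
          (gibbsK (F.refine n) ℰp (γ * ((F.L : ℝ)⁻¹) ^ n) K).real
            (histGood (F.refine n) ℰp (θBal (F.refine n).L (γ * ((F.L : ℝ)⁻¹) ^ n) b₀ p₀) K 0)ᶜ ≤ δ n := by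
  obtain ⟨b₀, p₀, γ₁, hb, hp, hγ₁, hbody⟩ := hM
  refine ⟨max b₀ b₁, max p₀ p₁, min γ₁ 1, le_max_right _ _, le_max_right _ _, hb.trans_le (le_max_left _ _),
    hp.trans_le (le_max_left _ _), lt_min hγ₁ one_pos, min_le_right _ _, fun F γ hFL hγ => ?_⟩
  obtain ⟨δ, hδ, hmass⟩ := hbody F γ hFL hγ
  exact ⟨δ, hδ, refinedMass_mono_profile F hγ (min_le_left γ₁ 1) (min_le_right γ₁ 1) hb.le (le_max_left _ _)
    (le_max_left _ _) hmass⟩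

/-- **THE ROUTE'S COMPOSITION AT ONE BLOCK SIZE.**  For a fixed block size `L₀`: the THRESHOLDED all-heights-tilt body at `L₀`
(r2 for profiles beyond `(b₁, p₁)`; the filed r2 is `b₁ = p₁ = 0`) and the r3 body at `L₀` give the fixed-block-size rung statement
`YM3TorusSU2At L₀` — threshold `γ₁ = 1`: r3's profile is pushed beyond `(b₁, p₁)` (`refinedMassBody_beyond`), for `0 < γ` one
passes to the refined families `F.refine n` (block size `F.L = L₀` by `rfl`) at couplings `γL₀^{-n} ≤ min γ₁ γ₂`, and the landed
widening `smallFieldWidening_wideningOfTiltAndMass_proof` + `continuumYM3Torus_iff_hasContinuumLimit_SU` conclude, exactly as in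
`Theses.SmallFieldWidening.closes`. [cite: Balaban1985UV3, (1)-(3) p.256] -/
theorem yM3TorusSU2At_of_bodies (L₀ : ℕ)
    (hT : ∃ b₁ p₁ : ℝ, ∀ (b₀ p₀ : ℝ), b₁ ≤ b₀ → p₁ ≤ p₀ → 0 < b₀ → 2 < p₀ →
      ∃ γ₂ : ℝ, 0 < γ₂ ∧ ∀ (F : T3Family) (γ : ℝ), F.L = L₀ → 0 < γ → γ ≤ γ₂ → UnitTiltAt F γ b₀ p₀ 0)
    (hM : ∃ (b₀ p₀ γ₁ : ℝ), 0 < b₀ ∧ 2 < p₀ ∧ 0 < γ₁ ∧ ∀ (F : T3Family) (γ : ℝ), F.L = L₀ → 0 < γ →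
      ∃ δ : ℕ → ℝ, Tendsto δ atTop (𝓝 0) ∧ ∀ n K : ℕ, γ * ((F.L : ℝ)⁻¹) ^ n ≤ γ₁ →
        (gibbsK (F.refine n) ℰp (γ * ((F.L : ℝ)⁻¹) ^ n) K).real
          (histGood (F.refine n) ℰp (θBal (F.refine n).L (γ * ((F.L : ℝ)⁻¹) ^ n) b₀ p₀) K 0)ᶜ ≤ δ n) :
    YM3TorusSU2At L₀ := by
  refine ⟨1, one_pos, fun F γ hFL hγ _ => ?_⟩
  obtain ⟨b₁, p₁, hT'⟩ := hT
  obtain ⟨b₀, p₀, γ₁, hb₁, hp₁, hb₀, hp₀, hγ₁, -, hM'⟩ := refinedMassBody_beyond L₀ b₁ p₁ hM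
  obtain ⟨γ₂, hγ₂, hT''⟩ := hT' b₀ p₀ hb₁ hp₁ hb₀ hp₀
  obtain ⟨δ, hδ, hmass⟩ := hM' F γ hFL hγ
  have hL : (1 : ℝ) < F.L := by exact_mod_cast F.hL.2
  have hL0 : (0 : ℝ) < F.L := zero_lt_one.trans hL
  have hq0 : 0 ≤ ((F.L : ℝ))⁻¹ := inv_nonneg.mpr hL0.le
  have hq1 : ((F.L : ℝ))⁻¹ ≤ 1 := inv_le_one_of_one_le₀ hL.le
  have hγs : 0 < min γ₁ γ₂ := lt_min hγ₁ hγ₂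
  obtain ⟨n₀, hn₀⟩ := ((tendsto_pow_atTop_nhds_zero_of_lt_one hq0
    (inv_lt_one_of_one_lt₀ hL)).eventually (ge_mem_nhds (div_pos hγs hγ))).exists
  have hle : ∀ n : ℕ, n₀ ≤ n → γ * ((F.L : ℝ)⁻¹) ^ n ≤ min γ₁ γ₂ := fun n hn =>
    calc γ * ((F.L : ℝ)⁻¹) ^ n ≤ γ * ((F.L : ℝ)⁻¹) ^ n₀ :=
          mul_le_mul_of_nonneg_left (pow_le_pow_of_le_one hq0 hq1 hn) hγ.le
      _ ≤ γ * (min γ₁ γ₂ / γ) := mul_le_mul_of_nonneg_left hn₀ hγ.le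
      _ = min γ₁ γ₂ := mul_div_cancel₀ _ hγ.ne'
  have hpos : ∀ n : ℕ, 0 < γ * ((F.L : ℝ)⁻¹) ^ n := fun n => mul_pos hγ (pow_pos (inv_pos.mpr hL0) n)
  have hlim : HasContinuumLimit (F.scheme ℰp γ) :=
    smallFieldWidening_wideningOfTiltAndMass_proof F γ b₀ p₀ n₀ hγ
      (fun n hn => hT'' (F.refine n) _ hFL (hpos n) ((hle n hn).trans (min_le_right _ _)))
      ⟨δ, hδ, fun n K hn => hmass n K ((hle n hn).trans (min_le_left _ _))⟩
  exact (continuumYM3Torus_iff_hasContinuumLimit_SU F ℰp measurableE_ℰp hγ.le).mpr hlim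

/-- The UNTHRESHOLDED r2 body at `L₀` (the filed shape of `AllHeightsSmallTilt`, read at one block size) is the thresholded one
with `b₁ = p₁ = 0`. [cite: King1986, Thm 3.4 (3.9) p.656] -/
theorem thresholded_of_allHeightsBody (L₀ : ℕ)
    (hT : ∀ (b₀ p₀ : ℝ), 0 < b₀ → 2 < p₀ →
      ∃ γ₂ : ℝ, 0 < γ₂ ∧ ∀ (F : T3Family) (γ : ℝ), F.L = L₀ → 0 < γ → γ ≤ γ₂ → UnitTiltAt F γ b₀ p₀ 0) :
    ∃ b₁ p₁ : ℝ, ∀ (b₀ p₀ : ℝ), b₁ ≤ b₀ → p₁ ≤ p₀ → 0 < b₀ → 2 < p₀ →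
      ∃ γ₂ : ℝ, 0 < γ₂ ∧ ∀ (F : T3Family) (γ : ℝ), F.L = L₀ → 0 < γ → γ ≤ γ₂ → UnitTiltAt F γ b₀ p₀ 0 :=
  ⟨0, 0, fun b₀ p₀ _ _ hb₀ hp₀ => hT b₀ p₀ hb₀ hp₀⟩

/-! ## §2 The floored closers -/

/-- **FLOORED CRUXES STILL CLOSE EVERY BLOCK SIZE ABOVE THE FLOOR.**  If the thresholded r2 body and the r3 body hold for every
block size `L ≥ L₁`, then `YM3TorusSU2At L₀` holds for every `L₀ ≥ L₁`. [cite: Balaban1985UV3, (1)-(3) p.256] -/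
theorem yM3TorusSU2At_of_bodies_from (L₁ : ℕ)
    (hT : ∀ L : ℕ, L₁ ≤ L → ∃ b₁ p₁ : ℝ, ∀ (b₀ p₀ : ℝ), b₁ ≤ b₀ → p₁ ≤ p₀ → 0 < b₀ → 2 < p₀ →
      ∃ γ₂ : ℝ, 0 < γ₂ ∧ ∀ (F : T3Family) (γ : ℝ), F.L = L → 0 < γ → γ ≤ γ₂ → UnitTiltAt F γ b₀ p₀ 0)
    (hM : ∀ L : ℕ, L₁ ≤ L → ∃ (b₀ p₀ γ₁ : ℝ), 0 < b₀ ∧ 2 < p₀ ∧ 0 < γ₁ ∧ ∀ (F : T3Family) (γ : ℝ), F.L = L → 0 < γ →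
      ∃ δ : ℕ → ℝ, Tendsto δ atTop (𝓝 0) ∧ ∀ n K : ℕ, γ * ((F.L : ℝ)⁻¹) ^ n ≤ γ₁ →
        (gibbsK (F.refine n) ℰp (γ * ((F.L : ℝ)⁻¹) ^ n) K).real
          (histGood (F.refine n) ℰp (θBal (F.refine n).L (γ * ((F.L : ℝ)⁻¹) ^ n) b₀ p₀) K 0)ᶜ ≤ δ n) :
    ∀ L₀ : ℕ, L₁ ≤ L₀ → YM3TorusSU2At L₀ :=
  fun L₀ hL₀ => yM3TorusSU2At_of_bodies L₀ (hT L₀ hL₀) (hM L₀ hL₀)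

/-- The same with the floor stated on ADMISSIBLE block sizes only (`Odd L ∧ L₁ ≤ L`): inadmissible block sizes carry no family, so
`YM3TorusSU2At L₀` holds there vacuously (`yM3TorusSU2At_of_not_admissible`). [cite: Balaban1985UV3, (1)-(3) p.256] -/
theorem yM3TorusSU2At_of_bodies_from_odd (L₁ : ℕ)
    (hT : ∀ L : ℕ, Odd L → L₁ ≤ L → ∃ b₁ p₁ : ℝ, ∀ (b₀ p₀ : ℝ), b₁ ≤ b₀ → p₁ ≤ p₀ → 0 < b₀ → 2 < p₀ →
      ∃ γ₂ : ℝ, 0 < γ₂ ∧ ∀ (F : T3Family) (γ : ℝ), F.L = L → 0 < γ → γ ≤ γ₂ → UnitTiltAt F γ b₀ p₀ 0)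
    (hM : ∀ L : ℕ, Odd L → L₁ ≤ L → ∃ (b₀ p₀ γ₁ : ℝ), 0 < b₀ ∧ 2 < p₀ ∧ 0 < γ₁ ∧ ∀ (F : T3Family) (γ : ℝ), F.L = L →
      0 < γ → ∃ δ : ℕ → ℝ, Tendsto δ atTop (𝓝 0) ∧ ∀ n K : ℕ, γ * ((F.L : ℝ)⁻¹) ^ n ≤ γ₁ →
        (gibbsK (F.refine n) ℰp (γ * ((F.L : ℝ)⁻¹) ^ n) K).real
          (histGood (F.refine n) ℰp (θBal (F.refine n).L (γ * ((F.L : ℝ)⁻¹) ^ n) b₀ p₀) K 0)ᶜ ≤ δ n) :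
    ∀ L₀ : ℕ, L₁ ≤ L₀ → YM3TorusSU2At L₀ := by
  intro L₀ hL₀
  by_cases hadm : Odd L₀ ∧ 1 < L₀
  · exact yM3TorusSU2At_of_bodies L₀ (hT L₀ hadm.1 hL₀) (hM L₀ hadm.1 hL₀)
  · exact yM3TorusSU2At_of_not_admissible hadm

/-- **THE ADMISSIBLE-BLOCK LEAF FROM FLOORED CRUXES.**  With the thresholded r2 body and the r3 body available for every odd block
size `L ≥ L₁`, `L₁ ≤ 12`, the print-faithful admissible-block form `YM3TorusSU2Adm` (every odd `L₀ > 11`, [Balaban1987RG1] §0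
p. 251) holds. [cite: Balaban1987RG1, §0 p.251] -/
theorem yM3TorusSU2Adm_of_bodies_from {L₁ : ℕ} (hL₁ : L₁ ≤ 12)
    (hT : ∀ L : ℕ, Odd L → L₁ ≤ L → ∃ b₁ p₁ : ℝ, ∀ (b₀ p₀ : ℝ), b₁ ≤ b₀ → p₁ ≤ p₀ → 0 < b₀ → 2 < p₀ →
      ∃ γ₂ : ℝ, 0 < γ₂ ∧ ∀ (F : T3Family) (γ : ℝ), F.L = L → 0 < γ → γ ≤ γ₂ → UnitTiltAt F γ b₀ p₀ 0)
    (hM : ∀ L : ℕ, Odd L → L₁ ≤ L → ∃ (b₀ p₀ γ₁ : ℝ), 0 < b₀ ∧ 2 < p₀ ∧ 0 < γ₁ ∧ ∀ (F : T3Family) (γ : ℝ), F.L = L →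
      0 < γ → ∃ δ : ℕ → ℝ, Tendsto δ atTop (𝓝 0) ∧ ∀ n K : ℕ, γ * ((F.L : ℝ)⁻¹) ^ n ≤ γ₁ →
        (gibbsK (F.refine n) ℰp (γ * ((F.L : ℝ)⁻¹) ^ n) K).real
          (histGood (F.refine n) ℰp (θBal (F.refine n).L (γ * ((F.L : ℝ)⁻¹) ^ n) b₀ p₀) K 0)ᶜ ≤ δ n) :
    YM3TorusSU2Adm :=
  fun L₀ hodd h11 => yM3TorusSU2At_of_bodies_from_odd L₁ hT hM L₀ (by omega)

/-- **r2 BY NAME, r3 FLOORED**: the all-heights tilt for every block size (crux `AllHeightsSmallTilt`) and the r3 body for every odd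
block size `L ≥ L₁`, `L₁ ≤ 12` ⇒ `YM3TorusSU2At L₀` for every `L₀ ≥ L₁`, and `YM3TorusSU2Adm`. [cite: Balaban1987RG1, §0 p.251] -/
theorem yM3TorusSU2Adm_of_allHeightsSmallTilt_of_from {L₁ : ℕ} (hL₁ : L₁ ≤ 12) (hT : AllHeightsSmallTilt)
    (hM : ∀ L : ℕ, Odd L → L₁ ≤ L → ∃ (b₀ p₀ γ₁ : ℝ), 0 < b₀ ∧ 2 < p₀ ∧ 0 < γ₁ ∧ ∀ (F : T3Family) (γ : ℝ), F.L = L →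
      0 < γ → ∃ δ : ℕ → ℝ, Tendsto δ atTop (𝓝 0) ∧ ∀ n K : ℕ, γ * ((F.L : ℝ)⁻¹) ^ n ≤ γ₁ →
        (gibbsK (F.refine n) ℰp (γ * ((F.L : ℝ)⁻¹) ^ n) K).real
          (histGood (F.refine n) ℰp (θBal (F.refine n).L (γ * ((F.L : ℝ)⁻¹) ^ n) b₀ p₀) K 0)ᶜ ≤ δ n) :
    (∀ L₀ : ℕ, L₁ ≤ L₀ → YM3TorusSU2At L₀) ∧ YM3TorusSU2Adm :=
  ⟨yM3TorusSU2At_of_bodies_from_odd L₁ (fun L _ _ => thresholded_of_allHeightsBody L (hT L)) hM,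
    yM3TorusSU2Adm_of_bodies_from hL₁ (fun L _ _ => thresholded_of_allHeightsBody L (hT L)) hM⟩

/-- **r3 BY NAME, r2 FLOORED (AND THRESHOLDED)**: the r3 crux `LargeFieldMassRefinementTail` and the thresholded all-heights-tilt
body for every odd block size `L ≥ L₁`, `L₁ ≤ 12` ⇒ `YM3TorusSU2At L₀` for every `L₀ ≥ L₁`, and `YM3TorusSU2Adm`.
[cite: Balaban1987RG1, §0 p.251] -/
theorem yM3TorusSU2Adm_of_from_of_largeFieldMassRefinementTail {L₁ : ℕ} (hL₁ : L₁ ≤ 12)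
    (hT : ∀ L : ℕ, Odd L → L₁ ≤ L → ∃ b₁ p₁ : ℝ, ∀ (b₀ p₀ : ℝ), b₁ ≤ b₀ → p₁ ≤ p₀ → 0 < b₀ → 2 < p₀ →
      ∃ γ₂ : ℝ, 0 < γ₂ ∧ ∀ (F : T3Family) (γ : ℝ), F.L = L → 0 < γ → γ ≤ γ₂ → UnitTiltAt F γ b₀ p₀ 0)
    (hM : LargeFieldMassRefinementTail) :
    (∀ L₀ : ℕ, L₁ ≤ L₀ → YM3TorusSU2At L₀) ∧ YM3TorusSU2Adm :=
  ⟨yM3TorusSU2At_of_bodies_from_odd L₁ hT (fun L _ _ => hM L), yM3TorusSU2Adm_of_bodies_from hL₁ hT fun L _ _ => hM L⟩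

/-! ## §3 Sanity: the unfloored cruxes give every fixed-block-size statement -/

/-- With both cruxes BY NAME (no floor, no thresholds) every fixed-block-size statement holds — block size by block size through
§1; equivalently through the route's own `closes` and `YM3TorusSU2.at`. [cite: Balaban1985UV3, (1)-(3) p.256] -/
theorem yM3TorusSU2At_of_cruxes (hT : AllHeightsSmallTilt) (hM : LargeFieldMassRefinementTail) (L₀ : ℕ) :
    YM3TorusSU2At L₀ :=
  yM3TorusSU2At_of_bodies L₀ (thresholded_of_allHeightsBody L₀ (hT L₀)) (hM L₀)

/-- The two readings agree.  (Up to route rev 4 this went through the route's deciding theorem `closes hT hM ‹widening›` and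
`YM3TorusSU2.at`; since rev 5 (2026-08-28, LINE g6-C) `closes` is keyed by the Cauchy door `WindowCondCauchy`/`CauchyAssembly`, and the
tilt reading is the assembly item `smallFieldWidening_assembly_proof` of `Theorems/SmallFieldWideningAssembly.lean`; here, import-free, §1.)
[cite: Balaban1985UV3, (1)-(3) p.256] -/
theorem yM3TorusSU2At_of_cruxes' (hT : AllHeightsSmallTilt) (hM : LargeFieldMassRefinementTail) (L₀ : ℕ) :
    YM3TorusSU2At L₀ :=
  yM3TorusSU2At_of_cruxes hT hM L₀

end Summit.QuantumFields.YangMills.Theorems.SmallFieldWideningBlocks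

end
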